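import Summits.CriticalPhenomena.PercolationContinuityZ3.Theorems.SahiMasterFamilyPhiAffine
import Summits.CriticalPhenomena.PercolationContinuityZ3.Theorems.SahiMasterFamilyPatchSingle

/-!
# `(UC-hull)` on every edge of Hamming length two, every order: if two union-closed families `𝒰, 𝒱 ∋ univ` differ by ONE set each
# (`𝒰 ∖ 𝒱 = {A}`, `𝒱 ∖ 𝒰 = {A'}`), then `Φ(w·1_𝒰 + (1−w)·1_𝒱) = w²Φ(1_𝒰) + (1−w)²Φ(1_𝒱) + w(1−w)(Φ(1_{𝒰∩𝒱}) + Φ(1_{𝒰∪𝒱})) ≥ 0`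

Unit `prim-masterthm-p4` (gen 21; crux anchor stmt-CriticalPhenomena-4575, helper work; memo
`run/shared/lean/prim/prim-masterthm/prim-masterthm-p4/P4-GEN21-REPORT.md` §3c).  Companion of `…PhiAffine` (Φ is affine along every single coordinate,
indeed along every intersecting-supported direction), `…PhiVertex` ((V)), `…PhiFreeIndex` / `…PatchSingle` (one free index).

THE POINT.  Bi-affine interpolation in the two coordinates `A, A'` writes the edge polynomial as the displayed Bernstein combination of FOUR vertex values.
Three of them are values at union-closed families (`𝒰`, `𝒱`, `𝒲 = 𝒰 ∩ 𝒱` — `𝒲` is union-closed because a union of two of its members lies in `𝒰 ∩ 𝒱`), hence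
`≥ 0` by (V).  The fourth, `𝒳 = 𝒰 ∪ 𝒱 = 𝒲 ∪ {A, A'}`, is in general NOT union-closed (`A ∪ A'` may be missing) — but it has a FREE INDEX: for any `z` lying in
exactly one of `A, A'` (say `z ∈ A ∖ A'`), the members of `𝒳` avoiding `z` are exactly the members of `𝒱` avoiding `z`, a union-closed family; so
`Φ(1_𝒳) ≥ 0` by `PhiFreeIndex.phiSet_nonneg_of_qp_off` (`phiSet_indicator_union_nonneg`).  Hence (`ucHull_edge_two`) the whole edge is nonnegative, and the
degree-`k` Bernstein coefficients of the edge polynomial are nonnegative (conjecture (B) of `…UCBernstein` on these edges), for EVERY order.  The case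
`A ∩ A' = ∅`, `A ∪ A' ∉ 𝒰 ∪ 𝒱` is neither min-closed nor of intersecting variation — a new (small) stratum; it is the simplest instance of the mechanism
"non-union-closed patchwork families controlled by a free index".  HONEST FRAMING: (B), `UCHullNonneg k` (k ≥ 8), Sahi's `C_k` and the master theorem remain OPEN.
Axioms standard. [this work]
-/

noncomputable section

open scoped Classical

namespace Summit.CriticalPhenomena.PercolationContinuityZ3.Theorems

namespace EdgeTwo

open Finset Function
open Literature.Combinatorics.Sahi2008
open PrincipalCapBeta (phiSet)

variable {k : ℕ}

/-- **A free index for `𝒲 ∪ {A, A'}`.**  If `𝒱 ∋ univ` is union-closed, `𝒳 ⊇ 𝒱`, and every member of `𝒳` avoiding `z` belongs to `𝒱`, then `Φ(1_𝒳) ≥ 0`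
(the restriction of `1_𝒳` off `z` is the indicator of a union-closed family, hence quotient-positive; the values on the sets containing `z` are free).
[this work] -/
theorem phiSet_indicator_nonneg_of_free_index (𝒳 𝒱 : Finset (Finset (Fin (k + 1))))
    (hV : ∀ S ∈ 𝒱, ∀ S' ∈ 𝒱, S ∪ S' ∈ 𝒱) (hVX : ∀ S ∈ 𝒱, S ∈ 𝒳) (htop : univ ∈ 𝒱) (z : Fin (k + 1))
    (hz : ∀ S ∈ 𝒳, z ∉ S → S ∈ 𝒱) :
    0 ≤ phiSet (k + 1) (fun S => if S ∈ 𝒳 then (1 : ℝ) else 0) := by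
  set P : Finset (Fin (k + 1)) → ℝ := fun S => if S ∈ 𝒳 then (1 : ℝ) else 0 with hP
  have hP1 : ∀ S, P S ≤ 1 := fun S => by simp only [hP]; split_ifs <;> norm_num
  have hP0 : ∀ S, 0 ≤ P S := fun S => by simp only [hP]; split_ifs <;> norm_num
  have huniv : P univ = 1 := by simp only [hP]; rw [if_pos (hVX _ htop)]
  refine PhiFreeIndex.phiSet_nonneg_of_qp_off P hP1 huniv z ?_
  set γ : Finset (Fin k) → ℝ := fun T => P ((T.map Fin.castSuccEmb).map (Equiv.swap z (Fin.last k)).toEmbedding) with hγ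
  have hγV : ∀ T, γ T = if (T.map Fin.castSuccEmb).map (Equiv.swap z (Fin.last k)).toEmbedding ∈ 𝒱 then 1 else 0 := by
    intro T
    simp only [hγ, hP]
    have hzT := PatchSingle.not_mem_image_swap z T
    by_cases hX : (T.map Fin.castSuccEmb).map (Equiv.swap z (Fin.last k)).toEmbedding ∈ 𝒳
    · rw [if_pos hX, if_pos (hz _ hX hzT)]
    · rw [if_neg hX, if_neg (fun hVm => hX (hVX _ hVm))]
  have hmin : ∀ S T, min (γ S) (γ T) ≤ γ (S ∪ T) := by
    intro S T
    rw [hγV, hγV, hγV, Finset.map_union, Finset.map_union]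
    by_cases hS : (S.map Fin.castSuccEmb).map (Equiv.swap z (Fin.last k)).toEmbedding ∈ 𝒱
    · by_cases hT : (T.map Fin.castSuccEmb).map (Equiv.swap z (Fin.last k)).toEmbedding ∈ 𝒱
      · rw [if_pos hS, if_pos hT, if_pos (hV _ hS _ hT)]; simp
      · rw [if_neg hT]; split_ifs <;> simp
    · rw [if_neg hS]; split_ifs <;> simp
  exact PhiCylinder.qp_of_minClosed γ (fun T => hP0 _) (fun T => hP1 _) hmin

/-- **`Φ(1_{𝒰 ∪ 𝒱}) ≥ 0` when `𝒰, 𝒱` are union-closed, contain `univ`, and differ by one set each** (`𝒰 ∖ 𝒱 = {A}`, `𝒱 ∖ 𝒰 = {A'}`), although `𝒰 ∪ 𝒱`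
need not be union-closed: an element lying in exactly one of `A, A'` is a free index. [this work] -/
theorem phiSet_indicator_union_nonneg (𝒰 𝒱 : Finset (Finset (Fin (k + 1))))
    (hU : ∀ S ∈ 𝒰, ∀ S' ∈ 𝒰, S ∪ S' ∈ 𝒰) (hV : ∀ S ∈ 𝒱, ∀ S' ∈ 𝒱, S ∪ S' ∈ 𝒱) (hUt : univ ∈ 𝒰) (hVt : univ ∈ 𝒱)
    {A A' : Finset (Fin (k + 1))} (hA : A ∈ 𝒰) (hA' : A' ∈ 𝒱) (hA'U : A' ∉ 𝒰)
    (hW : ∀ S, S ≠ A → S ≠ A' → (S ∈ 𝒰 ↔ S ∈ 𝒱)) :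
    0 ≤ phiSet (k + 1) (fun S => if S ∈ 𝒰 ∪ 𝒱 then (1 : ℝ) else 0) := by
  have hne : A ≠ A' := fun h => hA'U (h ▸ hA)
  by_cases hsub : A ⊆ A'
  · -- some `z ∈ A' ∖ A`: off `z`, members of `𝒰 ∪ 𝒱` are members of `𝒰`
    obtain ⟨z, hzA', hzA⟩ := Finset.exists_of_ssubset (lt_of_le_of_ne hsub hne)
    refine phiSet_indicator_nonneg_of_free_index (𝒰 ∪ 𝒱) 𝒰 hU (fun S hS => mem_union_left _ hS) hUt z fun S hS hzS => ?_
    rcases mem_union.1 hS with h | h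
    · exact h
    · have hSA' : S ≠ A' := fun e => hzS (e ▸ hzA')
      by_cases hSA : S = A
      · exact hSA ▸ hA
      · exact (hW S hSA hSA').2 h
  · -- some `z ∈ A ∖ A'`: off `z`, members of `𝒰 ∪ 𝒱` are members of `𝒱`
    obtain ⟨z, hzA, hzA'⟩ := Finset.not_subset.1 hsub
    refine phiSet_indicator_nonneg_of_free_index (𝒰 ∪ 𝒱) 𝒱 hV (fun S hS => mem_union_right _ hS) hVt z fun S hS hzS => ?_
    rcases mem_union.1 hS with h | h
    · have hSA : S ≠ A := fun e => hzS (e ▸ hzA)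
      by_cases hSA' : S = A'
      · exact hSA' ▸ hA'
      · exact (hW S hSA hSA').1 h
    · exact h

/-- **Bi-affine interpolation on an edge of Hamming length two.**  With `𝒲 = 𝒰 ∩ 𝒱` and `𝒳 = 𝒰 ∪ 𝒱`:
`Φ(w·1_𝒰 + (1−w)·1_𝒱) = w²Φ(1_𝒰) + (1−w)²Φ(1_𝒱) + w(1−w)(Φ(1_𝒲) + Φ(1_𝒳))` (Φ is affine in each of the two coordinates `A, A'`). [this work] -/
theorem phiSet_edge_two_eq (𝒰 𝒱 : Finset (Finset (Fin (k + 1))))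
    {A A' : Finset (Fin (k + 1))} (hA : A ∈ 𝒰) (hAV : A ∉ 𝒱) (hA' : A' ∈ 𝒱) (hA'U : A' ∉ 𝒰) (hAne : A.Nonempty) (hA'ne : A'.Nonempty)
    (hW : ∀ S, S ≠ A → S ≠ A' → (S ∈ 𝒰 ↔ S ∈ 𝒱)) (w : ℝ) :
    phiSet (k + 1) (fun S => w * (if S ∈ 𝒰 then (1 : ℝ) else 0) + (1 - w) * (if S ∈ 𝒱 then (1 : ℝ) else 0)) =
      w ^ 2 * phiSet (k + 1) (fun S => if S ∈ 𝒰 then (1 : ℝ) else 0) +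
      (1 - w) ^ 2 * phiSet (k + 1) (fun S => if S ∈ 𝒱 then (1 : ℝ) else 0) +
      w * (1 - w) * (phiSet (k + 1) (fun S => if S ∈ 𝒰 ∩ 𝒱 then (1 : ℝ) else 0) +
        phiSet (k + 1) (fun S => if S ∈ 𝒰 ∪ 𝒱 then (1 : ℝ) else 0)) := by
  have hne : A ≠ A' := fun h => hA'U (h ▸ hA)
  -- the two-parameter family `β s t = 1_𝒲 + s·e_A + t·e_{A'}`
  set β : ℝ → ℝ → Finset (Fin (k + 1)) → ℝ := fun s t S =>
    (if S ∈ 𝒰 ∩ 𝒱 then (1 : ℝ) else 0) + s * (if S = A then (1 : ℝ) else 0) + t * (if S = A' then (1 : ℝ) else 0) with hβ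
  -- affine in `s`
  have aff_s : ∀ s t, phiSet (k + 1) (β s t) = (1 - s) * phiSet (k + 1) (β 0 t) + s * phiSet (k + 1) (β 1 t) := by
    intro s t
    have e : β s t = fun S => (1 - s) * β 0 t S + s * β 1 t S := by funext S; simp only [hβ]; ring
    rw [e]
    refine PhiAffine.phiSet_lineMap_of_inter (β 0 t) (β 1 t) (fun S T hST => ?_) s
    simp only [hβ]
    by_cases hS : S = A
    · by_cases hT : T = A
      · subst hS; subst hT
        exact absurd (Finset.disjoint_self_iff_empty _ |>.1 hST) (Finset.nonempty_iff_ne_empty.1 hAne)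
      · rw [if_neg hT]; ring
    · rw [if_neg hS]; ring
  -- affine in `t`
  have aff_t : ∀ s t, phiSet (k + 1) (β s t) = (1 - t) * phiSet (k + 1) (β s 0) + t * phiSet (k + 1) (β s 1) := by
    intro s t
    have e : β s t = fun S => (1 - t) * β s 0 S + t * β s 1 S := by funext S; simp only [hβ]; ring
    rw [e]
    refine PhiAffine.phiSet_lineMap_of_inter (β s 0) (β s 1) (fun S T hST => ?_) t
    simp only [hβ]
    by_cases hS : S = A'
    · by_cases hT : T = A'
      · subst hS; subst hT
        exact absurd (Finset.disjoint_self_iff_empty _ |>.1 hST) (Finset.nonempty_iff_ne_empty.1 hA'ne)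
      · rw [if_neg hT]; ring
    · rw [if_neg hS]; ring
  -- the four corners and the edge point
  have cW : β 0 0 = fun S => if S ∈ 𝒰 ∩ 𝒱 then (1 : ℝ) else 0 := by funext S; simp only [hβ]; ring
  have cU : β 1 0 = fun S => if S ∈ 𝒰 then (1 : ℝ) else 0 := by
    funext S; simp only [hβ, zero_mul, add_zero, one_mul]
    by_cases hS : S = A
    · subst hS; rw [if_pos rfl, if_pos hA, if_neg (fun h => hAV (mem_inter.1 h).2)]; ring
    · rw [if_neg hS, add_zero]
      by_cases hSA' : S = A'
      · subst hSA'; rw [if_neg (fun h => hA'U (mem_inter.1 h).1), if_neg hA'U]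
      · by_cases hSU : S ∈ 𝒰
        · rw [if_pos (mem_inter.2 ⟨hSU, (hW S hS hSA').1 hSU⟩), if_pos hSU]
        · rw [if_neg (fun h => hSU (mem_inter.1 h).1), if_neg hSU]
  have cV : β 0 1 = fun S => if S ∈ 𝒱 then (1 : ℝ) else 0 := by
    funext S; simp only [hβ, zero_mul, add_zero, one_mul]
    by_cases hS : S = A'
    · subst hS; rw [if_pos rfl, if_pos hA', if_neg (fun h => hA'U (mem_inter.1 h).1)]; ring
    · rw [if_neg hS, add_zero]
      by_cases hSA : S = A
      · subst hSA; rw [if_neg (fun h => hAV (mem_inter.1 h).2), if_neg hAV]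
      · by_cases hSV : S ∈ 𝒱
        · rw [if_pos (mem_inter.2 ⟨(hW S hSA hS).2 hSV, hSV⟩), if_pos hSV]
        · rw [if_neg (fun h => hSV (mem_inter.1 h).2), if_neg hSV]
  have cX : β 1 1 = fun S => if S ∈ 𝒰 ∪ 𝒱 then (1 : ℝ) else 0 := by
    funext S; simp only [hβ, one_mul]
    by_cases hS : S = A
    · subst hS; rw [if_pos rfl, if_neg (fun h => hAV (mem_inter.1 h).2), if_neg hne, if_pos (mem_union_left _ hA)]; ring
    · rw [if_neg hS, add_zero]
      by_cases hSA' : S = A'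
      · subst hSA'; rw [if_pos rfl, if_neg (fun h => hA'U (mem_inter.1 h).1), if_pos (mem_union_right _ hA')]; ring
      · rw [if_neg hSA', add_zero]
        by_cases hSU : S ∈ 𝒰
        · rw [if_pos (mem_inter.2 ⟨hSU, (hW S hS hSA').1 hSU⟩), if_pos (mem_union_left _ hSU)]
        · have hSV : S ∉ 𝒱 := fun h => hSU ((hW S hS hSA').2 h)
          rw [if_neg (fun h => hSU (mem_inter.1 h).1), if_neg (fun h => by rcases mem_union.1 h with h | h <;> [exact hSU h; exact hSV h])]
  have cE : (fun S => w * (if S ∈ 𝒰 then (1 : ℝ) else 0) + (1 - w) * (if S ∈ 𝒱 then (1 : ℝ) else 0)) = β w (1 - w) := by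
    funext S
    have e1 := congrFun cU S
    have e2 := congrFun cV S
    simp only [hβ, one_mul, zero_mul, add_zero] at e1 e2 ⊢
    rw [← e1, ← e2]; ring
  rw [cE, aff_s w (1 - w), aff_t 0 (1 - w), aff_t 1 (1 - w), cW, cU, cV, cX]
  ring

/-- **`(UC-hull)` on every edge of Hamming length two, every order.**  If `𝒰, 𝒱 ∋ univ` are union-closed, `𝒰 ∖ 𝒱 = {A}` and `𝒱 ∖ 𝒰 = {A'}` (`A, A'` nonempty),
then `Φ(w·1_𝒰 + (1−w)·1_𝒱) ≥ 0` for every `w ∈ [0,1]` — by the bi-affine formula, (V) for `𝒰, 𝒱, 𝒰 ∩ 𝒱` and the free index for `𝒰 ∪ 𝒱`. [this work] -/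
theorem ucHull_edge_two (𝒰 𝒱 : Finset (Finset (Fin (k + 1))))
    (hU : ∀ S ∈ 𝒰, ∀ S' ∈ 𝒰, S ∪ S' ∈ 𝒰) (hV : ∀ S ∈ 𝒱, ∀ S' ∈ 𝒱, S ∪ S' ∈ 𝒱) (hUt : univ ∈ 𝒰) (hVt : univ ∈ 𝒱)
    {A A' : Finset (Fin (k + 1))} (hA : A ∈ 𝒰) (hAV : A ∉ 𝒱) (hA' : A' ∈ 𝒱) (hA'U : A' ∉ 𝒰) (hAne : A.Nonempty) (hA'ne : A'.Nonempty)
    (hW : ∀ S, S ≠ A → S ≠ A' → (S ∈ 𝒰 ↔ S ∈ 𝒱)) {w : ℝ} (hw0 : 0 ≤ w) (hw1 : w ≤ 1) :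
    0 ≤ phiSet (k + 1) (fun S => w * (if S ∈ 𝒰 then (1 : ℝ) else 0) + (1 - w) * (if S ∈ 𝒱 then (1 : ℝ) else 0)) := by
  rw [phiSet_edge_two_eq 𝒰 𝒱 hA hAV hA' hA'U hAne hA'ne hW w]
  have hk : 1 ≤ k + 1 := Nat.succ_le_succ (Nat.zero_le k)
  have gU := PhiVertex.phiSet_indicator_nonneg_of_unionClosed hk 𝒰 hU hUt
  have gV := PhiVertex.phiSet_indicator_nonneg_of_unionClosed hk 𝒱 hV hVt
  -- `𝒲 = 𝒰 ∩ 𝒱` is union-closed: a union of two members lies in `𝒰` and in `𝒱`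
  have hWuc : ∀ S ∈ 𝒰 ∩ 𝒱, ∀ S' ∈ 𝒰 ∩ 𝒱, S ∪ S' ∈ 𝒰 ∩ 𝒱 := fun S hS S' hS' =>
    mem_inter.2 ⟨hU _ (mem_inter.1 hS).1 _ (mem_inter.1 hS').1, hV _ (mem_inter.1 hS).2 _ (mem_inter.1 hS').2⟩
  have gW := PhiVertex.phiSet_indicator_nonneg_of_unionClosed hk (𝒰 ∩ 𝒱) hWuc (mem_inter.2 ⟨hUt, hVt⟩)
  have gX := phiSet_indicator_union_nonneg 𝒰 𝒱 hU hV hUt hVt hA hA' hA'U hW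
  have h1w : 0 ≤ 1 - w := sub_nonneg.2 hw1
  have t1 : 0 ≤ w ^ 2 * phiSet (k + 1) (fun S => if S ∈ 𝒰 then (1 : ℝ) else 0) := mul_nonneg (pow_nonneg hw0 2) gU
  have t2 : 0 ≤ (1 - w) ^ 2 * phiSet (k + 1) (fun S => if S ∈ 𝒱 then (1 : ℝ) else 0) := mul_nonneg (pow_nonneg h1w 2) gV
  have t3 : 0 ≤ w * (1 - w) * (phiSet (k + 1) (fun S => if S ∈ 𝒰 ∩ 𝒱 then (1 : ℝ) else 0) +
      phiSet (k + 1) (fun S => if S ∈ 𝒰 ∪ 𝒱 then (1 : ℝ) else 0)) := mul_nonneg (mul_nonneg hw0 h1w) (add_nonneg gW gX)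
  linarith

end EdgeTwo

end Summit.CriticalPhenomena.PercolationContinuityZ3.Theorems
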